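import Mathlib
import HarnessLib
import HarnessLib.Audit
import Summits.FinalStateConjecture.Statement
import HarnessLib.Audit.Status.Attr

/-!
Route: QuietWindowCapture

# Route QuietWindowCapture — finite dissipation budget ⇒ terminal quiet near-Kerr leaves ⇒ capture
by Kerr stability

It suffices to show X = QuietLeaves ∧ Capture ∧ GenericLegs (card
dissipation-budget-quiet-window-capture, Łojasiewicz–Simon scheme:
finite dissipation + quantitative rigidity near equilibria + local stability ⇒ convergence, with no
global compactness).
QuietLeaves (budget ⇒ terminal quietness ⇒ quantitative no-hair): every MGHD with complete 𝓘⁺ of an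
admissible datum contains, for every
Cᵏ-tolerance ε and beyond every compact set, an (ε,k)-NEAR-KERR LEAF — a hyperboloidal hypersurface
ε-close in Cᵏ to N ≤ N₀ boosted Kerr
star-regions {r_i > M_i} on near zones and to Minkowski outside them, masses in [m₀, 1/m₀]. Capture:
an MGHD of admissible data with
complete 𝓘⁺ whose late near-Kerr leaves exist for every tolerance with bounded complexity AND carry
a subextremality margin |aᵢ| ≤ χMᵢ
(χ < 1) once fine enough settles down exactly as the Statement demands (C² FinalStateDecomposition
on O = J⁺(ιX) ∩ I⁻(charts),
sub-extremal holes, HasExhaustiveCharts). GenericLegs: for Christodoulou-generic admissible data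
every MGHD has complete 𝓘⁺ AND a margin
on all its fine near-Kerr leaves (censorship + third law in ONE generic statement, because
curve-genericity is not closed under ∧); the
known support MGHDExists (Choquet-Bruhat–Geroch over the repaired structure, the item shared by the
sibling routes) supplies the
anti-vacuity conjunct.
Lean: `QuietLeaves ∧ Capture ∧ GenericLegs ∧ MGHDExists`

## Assembly
A few lines of logic, sorry-free in Sketch.lean / glue.lean (theorem `closes`, axioms
propext/choice/Quot.sound only): fix X and an
admissible datum; the late leaves of QuietLeaves and the margin (applied to those leaves when k ≥
k₁, ε ≤ ε₁) repackage into Capture's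
hypothesis, so MGHDExists, QuietLeaves and Capture turn the pointwise property "∀ MGHD, complete 𝓘⁺
∧ margin" into "MGHD exists ∧ ∀ MGHD,
complete 𝓘⁺ ∧ settles (sub-extremal, O = exteriorOf, exhaustive charts)", and Christodoulou
genericity (HasCodimAtLeastIn of the exceptional set) is
monotone under pointwise implication on the admissible class — the one-parameter family through an
exceptional datum of the weaker property
serves verbatim for the stronger one. No named Literature fact is consumed as a hypothesis.

Rationale: WHY THIS LINE. Two monotone quantities of black-hole thermodynamics — the Bondi mass (mass loss
∂ᵤM_B = −(32π)⁻¹∫|Ξ|², positivity M_B ≥ 0) and the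
event-horizon area (Raychaudhuri / area theorem, arXiv:gr-qc/0001003) — give every development with
complete 𝓘⁺ a finite, smallness-free
DISSIPATION BUDGET, and the tail of a convergent monotone function is ε-quiet for free; the whole
large-data content of the conjecture is then
ONE window-local quantitative no-hair statement (QR inside QuietLeaves), whose linear archetype is
the Duyckaerts–Kenig–Merle exterior
energy-channel inequality driving soliton resolution (arXiv:1912.07664, arXiv:2211.16075), made
plausible on Kerr by real-axis mode stability
in the full subextremal range (arXiv:2007.07211, arXiv:2302.08916), after which the perturbative
Kerr-stability architecture
(arXiv:2104.11857, arXiv:2205.14808, arXiv:2104.08222) captures the solution. Imported areas: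
gradient-flow convergence à la
Łojasiewicz–Simon (geometric analysis; L. Simon, Ann. Math. 118 (1983)), channels of energy
(dispersive PDE), black-hole thermodynamics as
the Lyapunov budget. Inside GR the symmetric instances are Dafermos–Rodnianski's Price-law scheme
(arXiv:math/0309115: budget + pigeonhole,
rigidity free by Birkhoff) and Luk–Oh–Yang (arXiv:1605.03893); this line replaces Birkhoff by the
quantitative no-hair crux and needs no
ω-limit compactness (contrast card lasalle-bondi-lyapunov-liouville). Sibling routes opened the same
hour (TwoBoundarySqueeze, GlobalAttraction, EternalPapapetrou, BeltLiouville, KerrnessPropagates, …)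
all pass through an ETERNAL object — an ω-limit, a C⁰ endpoint decomposition, recurrence to a fixed
configuration, or a Liouville theorem for stationary limits; this line's intermediate object is ONE
finite-tolerance leaf, so no late-time compactness and no Liouville theorem is a crux — the price,
stated openly, is that Capture must absorb N ≥ 2. Negatives index empty at filing.

RANKED CRUXES. #2 QuietLeaves (crux) — For every admissible datum D and every maximal vacuum Cauchy
development 𝒟 of D with complete 𝓘⁺ there are N₀ and m₀ > 0 such that for every k, every ε > 0 and
every compact K ⊆ 𝒟, 𝒟 contains an (ε,k)-near-Kerr leaf S disjoint from J⁻(K): N ≤ N₀ boosted Kerr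
star-region charts (0 < M_i, |a_i| ≤ M_i, m₀ ≤ M_i ≤ 1/m₀; rest-frame Kerr–Schild time and radius
about straight world-lines (Λ_i, c_i)) which are smooth open embeddings of the layer {−1 < t*_i < 1,
r_i < R_i + 1} into J⁺(ιX) and ε-close in Cᵏ (truncDeviationCk) on the slab {t*_i = 0, M_i < r_i ≤
R_i}; one flat chart on U₀ ⊇ {hyperboloidal time > −1, r_i > ρ_i ∀ i}, smooth open embedding of its
layer into J⁺(ιX), ε-close in Cᵏ (deviationCk) on the HYPERBOLOIDAL leaf {x⁰ − √(1+|x|²) = 0}; 0 <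
ρ_i < R_i with both overlap annuli charted by the other chart; pairwise disjoint near zones; upper
layers in I⁺(S); barrier clause exteriorOf(W) ∖ W ⊆ J⁻(S) for the upper layers W (finite-time copy
of the Statement's own covering device). Realises card items B1+B2 (Bondi-mass and area budgets ⇒
terminal ε-quiet future), QR (ε-quiet on a long window ⇒ near-Kerr leaf: the quantitative no-hair /
observability theorem) and FarField. [difficulty: open-problem] (why it might fail: QR is
conjectural even linearly (a Teukolsky observability/channels estimate on Kerr with derivative loss
from trapping); uniform N₀, m₀ need 'no late small holes'; the area budget needs sup A < ∞
(Penrose-type, open); Ric = 0 is essential (EKG hair is quiet).) [arXiv:1912.07664,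
arXiv:2211.16075, arXiv:2007.07211, arXiv:2302.08916, arXiv:gr-qc/0001003, arXiv:math/0309115,
arXiv:0902.1173, DafermosRodnianskiShlapentokhrothman2014]
#3 Capture (crux) — Let 𝒟 be a maximal vacuum Cauchy development of an admissible datum with
complete 𝓘⁺. If 𝒟 has NEAR-SUBEXTREMAL-KERR LEAVES — N₀, m₀ > 0, χ < 1, k₁, ε₁ > 0 such that for
every k, every ε > 0 and every compact K there is an (ε,k)-near-Kerr leaf S disjoint from J⁻(K) with
N ≤ N₀ holes of masses in [m₀, 1/m₀], which moreover has |a_i| ≤ χ·M_i for all i whenever k ≥ k₁ and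
ε ≤ ε₁ — then 𝒟 settles down exactly as in the Statement: there are O ⊆ 𝒟 and a C²
FinalStateDecomposition d of O with Kerr.IsSubextremal (d.mass i) (d.spin i) for all i, O =
exteriorOf 𝒟 d.charted and HasExhaustiveCharts d. Realises the card's Capture item: for leaves with
N ≤ 1 this is the sub-extremal Kerr stability conjecture (Dafermos–Rodnianski Conj. 5.1) fed with
interior hyperboloidal data plus Minkowski stability of the radiation zone; for N ≥ 2 it is
multi-Kerr capture. [difficulty: open-problem] (why it might fail: quiet ≠ settled: wide bound
binaries and late extreme-mass-ratio plunges pass every near-Kerr-leaf test, so N ≥ 2 hides the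
well-separated dissipative few-body/merger problem; leaf closeness is unweighted Cᵏ, stability
proofs consume weighted smallness; full |a|<M and N ≥ 2 exceed GKS.) [GiorgiKlainermanSzeftel2022,
KlainermanSzeftel2023, DafermosHolzegelRodnianskiTaylor2021, DafermosRodnianski2008,
arXiv:2211.15230, arXiv:2303.12758, arXiv:2601.01517]
#4 GenericLegs (crux) — For every connected Hausdorff second-countable smooth 3-manifold X the
following property is Christodoulou-generic of codimension ≥ 1 in admissibleVacuumData X (through
every admissible datum failing it passes a smooth injective one-parameter family of admissible data
all of whose other members satisfy it): EVERY maximal vacuum Cauchy development 𝒟 of the datum has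
complete 𝓘⁺ (Summit.FinalStateConjecture.HasCompleteNullInfinity) and a subextremality margin (∃ χ <
1, k₁, ε₁ > 0: for all k ≥ k₁ and ε ≤ ε₁, every (ε,k)-near-Kerr leaf of 𝒟 — at any epoch — has |a_i|
≤ χ·M_i). This is weak cosmic censorship (in the summit's own typing) together with a third-law /
transversality statement, bundled into ONE generic statement because Christodoulou curve-genericity
is not closed under conjunction (card genericity-is-not-closed-under-and). [difficulty:
open-problem] (why it might fail: contains weak cosmic censorship outright; extremal horizons form
from regular data (Kehle–Unger), so the margin is at best generic and its codimension-1 character is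
conjectural; two curve-generic properties need not have a curve-generic conjunction.)
[arXiv:2211.15742, arXiv:2402.10190, DafermosLuk2017, Christodoulou2008, Christodoulou1999,
DafermosRodnianski2008, Aretakis2015]
#9 MGHDExists (support) — Every admissible datum has a maximal vacuum Cauchy development over the
repaired structure (`VacuumCauchyDevelopment … IsMaximal`): Choquet-Bruhat–Geroch 1969 Thm 3,
Sbierski 2016 Thm 2.6 — the anti-vacuity conjunct of the Statement; a known theorem not yet vendored
over the repaired carrier; filed with the verbatim signature of the sibling routes' shared item
(stmt-FinalStateConjecture-9937) so that it deduplicates onto it. [difficulty: XL]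
[ChoquetBruhatGeroch1969CMP, Ringstrom2009, Sbierski2016AHP]

TWO-LAYER PLAN. Foreseen glued splits (none filed now). QuietLeaves ⇐ DissipationBudget (terminal
ε-quietness of the 𝓘⁺ news flux and of event-horizon
area growth after some retarded/advanced time; needs the definition requests below) →
QuantitativeNoHair (QR: an MGHD ε-quiet through
𝓘⁺ ∪ 𝓗⁺ on [u, ∞) carries (ε′,k)-near-Kerr leaves beyond every compact set, ε′ = ε′(ε,k) → 0; far
field by Klainerman–Nicolò exterior
stability) → QuietLeaves. Capture ⇐ TerminalCapture (near-Kerr leaves whose holes are mutually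
unbound/receding ⇒ settles: N × Kerr
stability + decaying tidal interactions) → FewBodyTerminal (a development with near-Kerr leaves for
every tolerance eventually has
TERMINAL ones: bound well-separated clusters merge within finitely many quiet epochs) → Capture.
GenericLegs ⇐ CensorshipLeg (generic:
complete 𝓘⁺ for every MGHD) → ThirdLawMargin (generic: margin) → JointTransversality (the two
exceptional sets are escaped by one common curve) →
GenericLegs.

KILL CRITERIA. refuted:QuietLeaves closes the route outright — a vacuum MGHD with complete 𝓘⁺ and no
near-Kerr leaves (an eternally radiating finite-energy
exterior / vacuum breather, or admissible data provably forming infinitely many ever-smaller late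
holes) kills the mechanism, and the
witness goes to card lasalle-bondi-lyapunov-liouville as negative knowledge. refuted:Capture by a
quiet-but-never-settling development
satisfying margin + leaves (e.g. an eternal bound N ≥ 2 configuration, or an exactly extremal merger
remnant under the margin hypothesis)
forces the pivot "restate Capture for terminal (unbound) leaves + file FewBodyTerminal as a crux"
rather than closure. refuted:GenericLegs
through an open (non-codimension-1) set of admissible data with incomplete 𝓘⁺ is ¬WCC and kills
every route of this summit as typed. The
route is mooted (superseded) if a route proves the per-datum conclusion for all admissible data with
complete 𝓘⁺ by compactness (LaSalle
line) — then Capture/QuietLeaves are bypassed.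

NOT DECOMPOSED YET. The budget identities themselves (Bondi mass loss + positivity; area law with
sup_v A(v) < ∞) and the tail/pigeonhole step — they need Bondi
mass and horizon area over `CauchyDevelopment` (the prelude's `BondiFoliation` sits on the
uninhabited `Development` carrier), see
Definition requests; the linear model of QR (Teukolsky observability on subextremal Kerr with flux
measured at 𝓘⁺ AND 𝓗⁺, window length
≳ log(1/ε) from trapping); the N ≤ 1 special case of Capture versus N ≥ 2; uniformity of capture
thresholds on compact parameter sets
(encoded only through N₀, m₀, χ); the readable parametrised predicate IsNearKerrLeaf
(sk/Consistency.lean proves the filed items are its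
verbatim inlining) — all layer-2 material.

CHEAPEST FALSIFIER. Linear toy of QR, runnable by a refuter with quasinormal-mode asymptotics: on
subextremal Kerr (worst case a → M, weakly damped
zero-damped modes) is there a finite-energy Teukolsky/wave solution whose flux through 𝓘⁺ ∪ 𝓗⁺ on a
window of length L is ≤ ε·(energy)
while its Cᵏ size on {r ≤ R} at mid-window stays ≥ c > 0, with L ≫ log(1/ε)? Exactly-zero flux
forever is excluded by real-axis mode
stability (Whiting 1989; arXiv:2007.07211, arXiv:2302.08916); a 'yes' for the windowed version at
fixed χ = a/M < 1 kills QuietLeaves'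
mechanism (not its statement) and demotes the route. Lookup falsifier: any published quiet non-Kerr
VACUUM exterior (none known; the
Einstein–Klein–Gordon hairy holes arXiv:1403.2757 show Ric = 0 is load-bearing). Not run here (no
kit in planner mode; the lookup half returned nothing: galaxy 'quantitative no-hair' 0 hits on all
corpora, zbMATH 0).

NUMBERS. Budget: ∫du ∫_S² |Ξ|² = 32π (M_ADM − M_B(∞)) ≤ 32π M_ADM (Christodoulou–Klainerman 1993,
17.0.8; Bondi-mass positivity Schoen–Yau 1982);
horizon: A(v) nondecreasing (area theorem, arXiv:gr-qc/0001003), conjecturally A ≤ 16π M_B²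
(Penrose). Perturbative reach: Kerr stability for
|a|/M ≪ 1 (arXiv:2104.11857 + arXiv:2205.14808, 2021–22), Schwarzschild in codimension 3
(arXiv:2104.08222), linear Teukolsky
boundedness/decay for all |a| < M (arXiv:2007.07211, arXiv:2302.08916); extremal Kerr: Aretakis
instability, and extremal horizons form in
finite time (arXiv:2211.15742). Items at open: 5 (3 cruxes + 1 shared support + assembly); longest
signature 3190 chars (Capture), all items one-line Props opened with `open
Literature.Geometry.Lorentzian in`.

DEFINITION REQUESTS. (1) notion BondiMassCauchy — Bondi mass M_B(u) along a retarded-time foliation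
of the outgoing cones of a `CauchyDevelopment` with
`HasCompleteFutureNullInfinity` (port of `BondiFoliation`/`IsCanonical`, BondiMass.lean, off the
uninhabited `Development` carrier), topic
Literature/Geometry/Lorentzian — needed to split DissipationBudget off QuietLeaves. (2) notion
EventHorizonArea — area A(v) of the
sections of ∂I⁻(far charted region) ∩ J⁺(ιX) along an advanced-time foliation, topic
Literature/Geometry/Lorentzian. (3) notion
IsNearKerrLeaf — the parametrised leaf predicate of this route (readable form in the planner folder
sk/Consistency.lean), topic
Summits/FinalStateConjecture/FinalStateConjecture/Theorems, so that tenure can restate the three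
items over it. Cite facts wanted: area
theorem (Chruściel–Delay–Galloway–Howard, arXiv:gr-qc/0001003, Thm 1.1); Bondi mass loss +
positivity over the new carrier.

Novelty: Searches (2026-08-15): card-level searches by the ideate/novelty-audit units (zbMATH 'quantitative
no-hair theorem almost stationary vacuum
black hole close to Kerr', 'small gravitational wave flux implies close to Kerr rigidity': 0 hits;
galaxy/crossref 0); this session:
`lit galaxy search "quantitative no-hair" --star all` (panama 0, pdf 0, crabby 0); `lit galaxy
search "no-hair theorem quantitative Kerr" --star all` (0); `lit search --source zbmath
"quantitative no-hair theorem Kerr black hole rigidity small flux"` (0); `lit search --source zbmath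
"Lojasiewicz-Simon Einstein equations black hole convergence"` (0); `lit search --source zbmath
"no-hair theorem quantitative"` (1: Krawczynski GRG 2018, observational Kerr-hypothesis tests —
unrelated); `lit search --source crossref "quantitative no-hair theorem Kerr small gravitational
wave flux rigidity"` (8: PN fluxes doi:10.1103/physrevd.90.044025, observational no-hair forecasts
doi:10.1103/physrevd.110.024058, Hod no-short-hair doi:10.1088/0264-9381/33/11/114001,
Lewandowski–Szereszewski doi:10.1103/physrevd.97.124067 — none a small-flux ⇒ near-Kerr theorem);
`lit frontier FinalStateConjecture --since 2020` (30 rows; nearest neighbours arXiv:2601.01517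
multi-black-hole Cauchy data, arXiv:2112.07183 Kerr–de Sitter stability, arXiv:2212.14093
quasilinear waves on Kerr — no dissipation-budget line); `lit bridges FinalStateConjecture --cross
any` (30 rows, surveys only); local searchd/OpenAlex/S2/arXiv APIs unavailable or rate  [refs: 10.1103/physrevd.90.044025, 10.1103/physrevd.110.024058, 10.1088/0264-9381/33/11/114001, 10.1103/physrevd.97.124067, 2601.01517, 2112.07183, 2212.14093, math/0309115, 1605.03893, 1912.07664, 2211.16075, 2205.14808, 0902.1173, doi:10.1103/physrevd.90.044025, doi:10.1103/physrevd.110.024058, doi:10.1088/0264-9381/33/11/114001, doi:10.1103/physrevd.97.124067]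

Barriers (technique_class: dissipation-budget, quantitative-rigidity, kerr-capture): - technique_class: dissipation-budget, quantitative-rigidity, kerr-capture
- Literature.Barriers.FinalStateConjecture.AretakisInstability: evaded by design — Capture carries
the subextremality-margin hypothesis and GenericLegs makes the margin generic;
exactly/asymptotically extremal developments sit in the exceptional set (consistent with
arXiv:2211.15742); QuietLeaves allows |a_i| ≤ M_i so it is not refuted by extremal formation.
- Literature.Barriers.FinalStateConjecture.AretakisInstabilityNarrow: same evasion — no item asserts
C² convergence at a degenerate horizon.
- Literature.Barriers.FinalStateConjecture.KerrSuperradiance: the budget uses Bondi mass and horizon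
AREA (sign-definite growth), never the ∂ₜ-energy; QR measures flux at 𝓘⁺ AND 𝓗⁺, so superradiant
amplification is charged to the horizon budget.
- Literature.Barriers.FinalStateConjecture.PriceLawTail: QuietLeaves asks ε-closeness on some late
leaf with no rate; polynomial tails only delay the leaf — evaded.
- Literature.Barriers.FinalStateConjecture.KerrLinearHair: massive (Klein–Gordon) hair is quiet and
non-decaying; QuietLeaves/Capture are stated for VACUUM MGHDs only — Ric = 0 is load-bearing, as the
card records.
- Literature.Barriers.FinalStateConjecture.HairyKerrBifurcation: same — Einstein–Klein–Gordon hairy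
black holes are outside the vacuum class the items quantify over.
- Literature.Barriers.FinalStateConjecture.HairyKerrBifurcationNarrow: same as HairyKerrBifurcation.
- Literature.Barriers.FinalSta

sub-problem: FinalStateConjecture · status: blocked · opened planner-plancard-FinalStateConjecture-FinalSt-7d35149b-0 2026-08-15T15:12:31Z · rev 2 · ledger route-FinalStateConjecture-QuietWindowCapture
GENERATED by the gate from the ledger (D-0016/17). Provers cite these decls: `theorem foo : Summit.FinalStateConjecture.FinalStateConjecture.Theses.QuietWindowCapture.<Decl> := …` in Summits/FinalStateConjecture/FinalStateConjecture/Theorems/<Name>.lean.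
-/

namespace Summit.FinalStateConjecture.FinalStateConjecture.Theses.QuietWindowCapture

open scoped BigOperators Topology Manifold Classical MeasureTheory ProbabilityTheory Matrix InnerProductSpace ComplexConjugate ContinuousMap
open Filter Set Function TopologicalSpace MeasureTheory

attribute [summit_statement] _root_.FinalStateConjecture

/-- item stmt-FinalStateConjecture-10114 · crux · rank 2 · open · by planner
why it might fail: QR quantifies two OPEN rigidity steps (zero flux ⇒ stationary: known only near 𝓘, Alexakis–Schlue; stationary ⇒ Kerr: only analytic/near-Kerr, AIK) and is open even for windowed linear Teukolsky; uniform N₀,m₀ forbid cascades of ever-smaller late holes; ∀k vs o₂ data: rough tails cross every leaf.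
sources: AlexakisSchlue2018, arXiv:1504.04592, AlexakisIonescuKlainerman2010, Literature.Barriers.FinalStateConjecture.IonescuKlainermanNonExtension, arXiv:2007.07211, arXiv:2302.08916
[crux] For every admissible datum D and every maximal vacuum Cauchy development 𝒟 of D with complete
𝓘⁺ there are N₀ and m₀ > 0 such that for every k, every ε > 0 and every compact K ⊆ 𝒟, 𝒟 contains an
(ε,k)-near-Kerr leaf S disjoint from J⁻(K): N ≤ N₀ boosted Kerr star-region charts (0 < M_i, |a_i| ≤
M_i, m₀ ≤ M_i ≤ 1/m₀; rest-frame Kerr–Schild time and radius about straight world-lines (Λ_i, c_i))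
which are smooth open embeddings of the layer {−1 < t*_i < 1, r_i < R_i + 1} into J⁺(ιX) and ε-close
in Cᵏ (truncDeviationCk) on the slab {t*_i = 0, M_i < r_i ≤ R_i}; one flat chart on U₀ ⊇
{hyperboloidal time > −1, r_i > ρ_i ∀ i}, smooth open embedding of its layer into J⁺(ιX), ε-close in
Cᵏ (deviationCk) on the HYPERBOLOIDAL leaf {x⁰ − √(1+|x|²) = 0}; 0 < ρ_i < R_i with both overlap
annuli charted by the other chart; pairwise disjoint near zones; upper layers in I⁺(S); barrier
clause exteriorOf(W) ∖ W ⊆ J⁻(S) for the upper layers W (finite-time copy of the Statement's own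
covering device). Realises card items B1+B2 (Bondi-mass and area budgets ⇒ terminal ε-quiet future),
QR (ε-quiet on a long window ⇒ near-Kerr leaf: the quantitative no-hair / observability theorem) and
FarField. [dif -/
@[route_item "route-FinalStateConjecture-QuietWindowCapture", crux]
def QuietLeaves : Prop :=
  open Literature.Geometry.Lorentzian in ∀ (X : Type) [TopologicalSpace X] [ChartedSpace E3 X] [IsManifold (𝓡 3) ((⊤ : ℕ∞) : WithTop ℕ∞) X] [T2Space X] [SecondCountableTopology X] [ConnectedSpace X], ∀ D ∈ admissibleVacuumData X, ∀ 𝒟 : VacuumCauchyDevelopment D, 𝒟.IsMaximal → Summit.FinalStateConjecture.HasCompleteNullInfinity 𝒟.toCauchyDevelopment → (∃ (N₀ : ℕ) (m₀ : ℝ), 0 < m₀ ∧ ∀ (k : ℕ) (ε : ENNReal), 0 < ε → ∀ K : Set 𝒟.carrier, IsCompact K → ∃ (N : ℕ) (M a : Fin N → ℝ) (S : Set 𝒟.carrier), N ≤ N₀ ∧ (∀ i, m₀ ≤ M i ∧ M i ≤ m₀⁻¹) ∧ Disjoint S (𝒟.metric.causalPast 𝒟.timeOrientation K) ∧ (∃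 (R ρ : Fin N → ℝ) (mo : Fin N → lorentzGroup × E4) (r : Fin N → E4 → ℝ) (B : Fin N → ModelBackground) (U₀ : TopologicalSpace.Opens E4) (B₀ : ModelBackground) (Ψ : ∀ i, (B i).domain → 𝒟.carrier) (Ψ₀ : B₀.domain → 𝒟.carrier) (L W : ∀ i, Set (B i).domain) (L₀ W₀ : Set B₀.domain), (∀ i, r i = fun x => Kerr.radius (a i) (poincareInv (mo i).1 (mo i).2 x)) ∧ (∀ i, B i = (⟨⟨poincareInv (mo i).1 (mo i).2 ⁻¹' (Kerr.region (a i) (M i) : Set E4), (Kerr.region (a i) (M i)).isOpen.preimage (continuous_poincareInv (mo i).1 (mo i).2)⟩, boostedKerrBilin (mo i).1 (mo i).2 (M i) (a i), fun x => poincareInv (mo i).1 (mo i).2 x 0, r i⟩ : ModelBackground)) ∧ B₀ = (⟨U₀, fun _ => Minkowski.bilin, fun x => x 0 - Real.sqrt (1 + E4.spatialNorm x ^ 2), E4.spatialNorm⟩ : ModelBackground) ∧ (∀ i, L i = {x | -1 < (B i).time x.1 ∧ (B i).time x.1 < 1 ∧ (B i).radius x.1 < R i + 1} ∧ W i = {x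 | 0 < (B i).time x.1 ∧ (B i).time x.1 < 1 ∧ (B i).radius x.1 ≤ R i}) ∧ L₀ = {x | -1 < B₀.time x.1 ∧ B₀.time x.1 < 1} ∧ W₀ = {x | 0 < B₀.time x.1 ∧ B₀.time x.1 < 1} ∧ (∀ i, 0 < M i ∧ |a i| ≤ M i ∧ 0 < ρ i ∧ ρ i < R i) ∧ {x : E4 | -1 < x 0 - Real.sqrt (1 + E4.spatialNorm x ^ 2) ∧ ∀ i, ρ i < r i x} ⊆ (U₀ : Set E4) ∧ (∀ i, ContMDiffOn 𝓘(ℝ, E4) (𝓡 4) ((⊤ : ℕ∞) : WithTop ℕ∞) (Ψ i) (L i) ∧ Topology.IsOpenEmbedding ((L i).restrict (Ψ i)) ∧ Ψ i '' L i ⊆ 𝒟.metric.causalFuture 𝒟.timeOrientation (Set.range 𝒟.embed)) ∧ ContMDiffOn 𝓘(ℝ, E4) (𝓡 4) ((⊤ : ℕ∞) : WithTop ℕ∞) Ψ₀ L₀ ∧ Topology.IsOpenEmbedding (L₀.restrict Ψ₀) ∧ Ψ₀ '' L₀ ⊆ 𝒟.metric.causalFuture 𝒟.timeOrientation (Set.range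 𝒟.embed) ∧ (∀ i, 𝒟.toSpacetime.truncDeviationCk (B i) (Ψ i) k (R i) 0 ≤ ε) ∧ 𝒟.toSpacetime.deviationCk B₀ Ψ₀ k 0 ≤ ε ∧ Pairwise (Function.onFun Disjoint fun i => Ψ i '' {x | x ∈ L i ∧ (B i).radius x.1 ≤ R i}) ∧ (∀ i, Ψ i '' {x | (B i).time x.1 = 0 ∧ ρ i < (B i).radius x.1 ∧ (B i).radius x.1 ≤ R i} ⊆ Ψ₀ '' L₀) ∧ (∀ i, Ψ₀ '' {x | B₀.time x.1 = 0 ∧ ρ i < r i x.1 ∧ r i x.1 < R i} ⊆ Ψ i '' L i) ∧ S = Ψ₀ '' B₀.timeSlab 0 ∪ ⋃ i, Ψ i '' (B i).truncTimeSlab (R i) 0 ∧ Ψ₀ '' W₀ ∪ ⋃ i, Ψ i '' W i ⊆ 𝒟.metric.chronologicalFuture 𝒟.timeOrientation S ∧ Summit.FinalStateConjecture.exteriorOf 𝒟.toCauchyDevelopment (Ψ₀ '' W₀ ∪ ⋃ i, Ψ i '' W i) \ (Ψ₀ '' W₀ ∪ ⋃ i, Ψ i '' W i) ⊆ 𝒟.metric.causalPast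 𝒟.timeOrientation S))

/-- item stmt-FinalStateConjecture-10115 · crux · rank 3 · open · by planner
why it might fail: Leaves are mere snapshots fixing no velocities: for N₀ ≥ 2 the dissipative few-body/merger motion between fine leaves has no theorem; for N₀ ≤ 1 unweighted-Cᵏ hyperboloidal data, uniform on |a| ≤ χM, must reach Kerr stability, known only from AF polyhomogeneous data (Hintz 2026 claim) or for |a|≪M.
sources: Hintz2026, arXiv:2606.28253, GiorgiKlainermanSzeftel2022, KlainermanSzeftel2023, DafermosHolzegelRodnianskiTaylor2021, arXiv:2303.12758
[crux] Let 𝒟 be a maximal vacuum Cauchy development of an admissible datum with complete 𝓘⁺. If 𝒟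
has NEAR-SUBEXTREMAL-KERR LEAVES — N₀, m₀ > 0, χ < 1, k₁, ε₁ > 0 such that for every k, every ε > 0
and every compact K there is an (ε,k)-near-Kerr leaf S disjoint from J⁻(K) with N ≤ N₀ holes of
masses in [m₀, 1/m₀], which moreover has |a_i| ≤ χ·M_i for all i whenever k ≥ k₁ and ε ≤ ε₁ — then 𝒟
settles down exactly as in the Statement: there are O ⊆ 𝒟 and a C² FinalStateDecomposition d of O
with Kerr.IsSubextremal (d.mass i) (d.spin i) for all i, O = exteriorOf 𝒟 d.charted and
HasExhaustiveCharts d. Realises the card's Capture item: for leaves with N ≤ 1 this is the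
sub-extremal Kerr stability conjecture (Dafermos–Rodnianski Conj. 5.1) fed with interior
hyperboloidal data plus Minkowski stability of the radiation zone; for N ≥ 2 it is multi-Kerr
capture. [difficulty: open-problem] -/
@[route_item "route-FinalStateConjecture-QuietWindowCapture", crux]
def Capture : Prop :=
  open Literature.Geometry.Lorentzian in ∀ (X : Type) [TopologicalSpace X] [ChartedSpace E3 X] [IsManifold (𝓡 3) ((⊤ : ℕ∞) : WithTop ℕ∞) X] [T2Space X] [SecondCountableTopology X] [ConnectedSpace X], ∀ D ∈ admissibleVacuumData X, ∀ 𝒟 : VacuumCauchyDevelopment D, 𝒟.IsMaximal → Summit.FinalStateConjecture.HasCompleteNullInfinity 𝒟.toCauchyDevelopment → (∃ (N₀ : ℕ) (m₀ χ : ℝ) (k₁ : ℕ) (ε₁ : ENNReal), 0 < m₀ ∧ χ < 1 ∧ 0 < ε₁ ∧ ∀ (k : ℕ) (ε : ENNReal), 0 < ε → ∀ K : Set 𝒟.carrier, IsCompact K → ∃ (N : ℕ) (M a : Fin N → ℝ) (S : Set 𝒟.carrier), N ≤ N₀ ∧ (∀ i, m₀ ≤ M i ∧ M i ≤ m₀⁻¹)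 ∧ Disjoint S (𝒟.metric.causalPast 𝒟.timeOrientation K) ∧ (∃ (R ρ : Fin N → ℝ) (mo : Fin N → lorentzGroup × E4) (r : Fin N → E4 → ℝ) (B : Fin N → ModelBackground) (U₀ : TopologicalSpace.Opens E4) (B₀ : ModelBackground) (Ψ : ∀ i, (B i).domain → 𝒟.carrier) (Ψ₀ : B₀.domain → 𝒟.carrier) (L W : ∀ i, Set (B i).domain) (L₀ W₀ : Set B₀.domain), (∀ i, r i = fun x => Kerr.radius (a i) (poincareInv (mo i).1 (mo i).2 x)) ∧ (∀ i, B i = (⟨⟨poincareInv (mo i).1 (mo i).2 ⁻¹' (Kerr.region (a i) (M i) : Set E4), (Kerr.region (a i) (M i)).isOpen.preimage (continuous_poincareInv (mo i).1 (mo i).2)⟩, boostedKerrBilin (mo i).1 (mo i).2 (M i) (a i), fun x => poincareInv (mo i).1 (mo i).2 x 0, r i⟩ : ModelBackground)) ∧ B₀ = (⟨U₀, fun _ => Minkowski.bilin, fun x => x 0 - Real.sqrt (1 + E4.spatialNorm x ^ 2), E4.spatialNorm⟩ : ModelBackground) ∧ (∀ i, L i = {x | -1 < (B i).time x.1 ∧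 (B i).time x.1 < 1 ∧ (B i).radius x.1 < R i + 1} ∧ W i = {x | 0 < (B i).time x.1 ∧ (B i).time x.1 < 1 ∧ (B i).radius x.1 ≤ R i}) ∧ L₀ = {x | -1 < B₀.time x.1 ∧ B₀.time x.1 < 1} ∧ W₀ = {x | 0 < B₀.time x.1 ∧ B₀.time x.1 < 1} ∧ (∀ i, 0 < M i ∧ |a i| ≤ M i ∧ 0 < ρ i ∧ ρ i < R i) ∧ {x : E4 | -1 < x 0 - Real.sqrt (1 + E4.spatialNorm x ^ 2) ∧ ∀ i, ρ i < r i x} ⊆ (U₀ : Set E4) ∧ (∀ i, ContMDiffOn 𝓘(ℝ, E4) (𝓡 4) ((⊤ : ℕ∞) : WithTop ℕ∞) (Ψ i) (L i) ∧ Topology.IsOpenEmbedding ((L i).restrict (Ψ i)) ∧ Ψ i '' L i ⊆ 𝒟.metric.causalFuture 𝒟.timeOrientation (Set.range 𝒟.embed)) ∧ ContMDiffOn 𝓘(ℝ, E4) (𝓡 4) ((⊤ : ℕ∞) : WithTop ℕ∞) Ψ₀ L₀ ∧ Topology.IsOpenEmbedding (L₀.restrict Ψ₀) ∧ Ψ₀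 '' L₀ ⊆ 𝒟.metric.causalFuture 𝒟.timeOrientation (Set.range 𝒟.embed) ∧ (∀ i, 𝒟.toSpacetime.truncDeviationCk (B i) (Ψ i) k (R i) 0 ≤ ε) ∧ 𝒟.toSpacetime.deviationCk B₀ Ψ₀ k 0 ≤ ε ∧ Pairwise (Function.onFun Disjoint fun i => Ψ i '' {x | x ∈ L i ∧ (B i).radius x.1 ≤ R i}) ∧ (∀ i, Ψ i '' {x | (B i).time x.1 = 0 ∧ ρ i < (B i).radius x.1 ∧ (B i).radius x.1 ≤ R i} ⊆ Ψ₀ '' L₀) ∧ (∀ i, Ψ₀ '' {x | B₀.time x.1 = 0 ∧ ρ i < r i x.1 ∧ r i x.1 < R i} ⊆ Ψ i '' L i) ∧ S = Ψ₀ '' B₀.timeSlab 0 ∪ ⋃ i, Ψ i '' (B i).truncTimeSlab (R i) 0 ∧ Ψ₀ '' W₀ ∪ ⋃ i, Ψ i '' W i ⊆ 𝒟.metric.chronologicalFuture 𝒟.timeOrientation S ∧ Summit.FinalStateConjecture.exteriorOf 𝒟.toCauchyDevelopment (Ψ₀ '' W₀ ∪ ⋃ i, Ψ i '' W i) \ (Ψ₀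 '' W₀ ∪ ⋃ i, Ψ i '' W i) ⊆ 𝒟.metric.causalPast 𝒟.timeOrientation S) ∧ (k₁ ≤ k → ε ≤ ε₁ → ∀ i, |a i| ≤ χ * M i)) → (∃ (O : Set 𝒟.carrier) (d : FinalStateDecomposition 𝒟.toSpacetime O 2), (∀ i, Kerr.IsSubextremal (d.mass i) (d.spin i)) ∧ O = Summit.FinalStateConjecture.exteriorOf 𝒟.toCauchyDevelopment d.charted ∧ Summit.FinalStateConjecture.HasExhaustiveCharts d)

/-- item stmt-FinalStateConjecture-10116 · crux · rank 4 · open · by planner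
why it might fail: MISSTATED (rreview-0815T15-6, PhantomHole.lean): margin ranges over ALL typed leaves incl. phantom holes (R_i ≤ M_i ⇒ empty certified slab, a_i = M_i free) ⇒ with QuietLeaves+MGHDExists forces admissibleVacuumData = ∅; repair 2M_i ≤ R_i + mass window. Content: WCC + generic third law, open.
sources: evidence:stmt-FinalStateConjecture-10116/20260815T153800Z-PhantomHole.lean (refuter-rreview-0815T15-6-0: QWCReview.phantom_certifies_nothing, items_force_no_admissible_data), Christodoulou1999, DafermosLuk2017, Christodoulou2008, KehleUnger2025, arXiv:2211.15742
[crux] For every connected Hausdorff second-countable smooth 3-manifold X the following property is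
Christodoulou-generic of codimension ≥ 1 in admissibleVacuumData X (through every admissible datum
failing it passes a smooth injective one-parameter family of admissible data all of whose other
members satisfy it): EVERY maximal vacuum Cauchy development 𝒟 of the datum has complete 𝓘⁺
(Summit.FinalStateConjecture.HasCompleteNullInfinity) and a subextremality margin (∃ χ < 1, k₁, ε₁ >
0: for all k ≥ k₁ and ε ≤ ε₁, every (ε,k)-near-Kerr leaf of 𝒟 — at any epoch — has |a_i| ≤ χ·M_i).
This is weak cosmic censorship (in the summit's own typing) together with a third-law /
transversality statement, bundled into ONE generic statement because Christodoulou curve-genericity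
is not closed under conjunction (card genericity-is-not-closed-under-and). [difficulty:
open-problem] -/
@[route_item "route-FinalStateConjecture-QuietWindowCapture", crux]
def GenericLegs : Prop :=
  open Literature.Geometry.Lorentzian in ∀ (X : Type) [TopologicalSpace X] [ChartedSpace E3 X] [IsManifold (𝓡 3) ((⊤ : ℕ∞) : WithTop ℕ∞) X] [T2Space X] [SecondCountableTopology X] [ConnectedSpace X], InitialDataSet.IsChristodoulouGeneric (admissibleVacuumData X) (fun D => ∀ 𝒟 : VacuumCauchyDevelopment D, 𝒟.IsMaximal → Summit.FinalStateConjecture.HasCompleteNullInfinity 𝒟.toCauchyDevelopment ∧ (∃ (χ : ℝ) (k₁ : ℕ) (ε₁ : ENNReal), χ < 1 ∧ 0 < ε₁ ∧ ∀ (k : ℕ) (ε : ENNReal), k₁ ≤ k → ε ≤ ε₁ → ∀ (N : ℕ) (M a : Fin N → ℝ) (S : Set 𝒟.carrier), (∃ (R ρ : Fin N → ℝ) (mo : Fin N → lorentzGroup × E4) (r : Fin N → E4 → ℝ) (B : Fin N → ModelBackground) (U₀ : TopologicalSpace.Opens E4) (B₀ : ModelBackground) (Ψ : ∀ i, (B i).domain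 → 𝒟.carrier) (Ψ₀ : B₀.domain → 𝒟.carrier) (L W : ∀ i, Set (B i).domain) (L₀ W₀ : Set B₀.domain), (∀ i, r i = fun x => Kerr.radius (a i) (poincareInv (mo i).1 (mo i).2 x)) ∧ (∀ i, B i = (⟨⟨poincareInv (mo i).1 (mo i).2 ⁻¹' (Kerr.region (a i) (M i) : Set E4), (Kerr.region (a i) (M i)).isOpen.preimage (continuous_poincareInv (mo i).1 (mo i).2)⟩, boostedKerrBilin (mo i).1 (mo i).2 (M i) (a i), fun x => poincareInv (mo i).1 (mo i).2 x 0, r i⟩ : ModelBackground)) ∧ B₀ = (⟨U₀, fun _ => Minkowski.bilin, fun x => x 0 - Real.sqrt (1 + E4.spatialNorm x ^ 2), E4.spatialNorm⟩ : ModelBackground) ∧ (∀ i, L i = {x | -1 < (B i).time x.1 ∧ (B i).time x.1 < 1 ∧ (B i).radius x.1 < R i + 1} ∧ W i = {x | 0 < (B i).time x.1 ∧ (B i).time x.1 < 1 ∧ (B i).radius x.1 ≤ R i}) ∧ L₀ = {x | -1 < B₀.time x.1 ∧ B₀.time x.1 < 1} ∧ W₀ = {x | 0 < B₀.time x.1 ∧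 B₀.time x.1 < 1} ∧ (∀ i, 0 < M i ∧ |a i| ≤ M i ∧ 0 < ρ i ∧ ρ i < R i) ∧ {x : E4 | -1 < x 0 - Real.sqrt (1 + E4.spatialNorm x ^ 2) ∧ ∀ i, ρ i < r i x} ⊆ (U₀ : Set E4) ∧ (∀ i, ContMDiffOn 𝓘(ℝ, E4) (𝓡 4) ((⊤ : ℕ∞) : WithTop ℕ∞) (Ψ i) (L i) ∧ Topology.IsOpenEmbedding ((L i).restrict (Ψ i)) ∧ Ψ i '' L i ⊆ 𝒟.metric.causalFuture 𝒟.timeOrientation (Set.range 𝒟.embed)) ∧ ContMDiffOn 𝓘(ℝ, E4) (𝓡 4) ((⊤ : ℕ∞) : WithTop ℕ∞) Ψ₀ L₀ ∧ Topology.IsOpenEmbedding (L₀.restrict Ψ₀) ∧ Ψ₀ '' L₀ ⊆ 𝒟.metric.causalFuture 𝒟.timeOrientation (Set.range 𝒟.embed) ∧ (∀ i, 𝒟.toSpacetime.truncDeviationCk (B i) (Ψ i) k (R i) 0 ≤ ε) ∧ 𝒟.toSpacetime.deviationCk B₀ Ψ₀ k 0 ≤ ε ∧ Pairwise (Function.onFun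 Disjoint fun i => Ψ i '' {x | x ∈ L i ∧ (B i).radius x.1 ≤ R i}) ∧ (∀ i, Ψ i '' {x | (B i).time x.1 = 0 ∧ ρ i < (B i).radius x.1 ∧ (B i).radius x.1 ≤ R i} ⊆ Ψ₀ '' L₀) ∧ (∀ i, Ψ₀ '' {x | B₀.time x.1 = 0 ∧ ρ i < r i x.1 ∧ r i x.1 < R i} ⊆ Ψ i '' L i) ∧ S = Ψ₀ '' B₀.timeSlab 0 ∪ ⋃ i, Ψ i '' (B i).truncTimeSlab (R i) 0 ∧ Ψ₀ '' W₀ ∪ ⋃ i, Ψ i '' W i ⊆ 𝒟.metric.chronologicalFuture 𝒟.timeOrientation S ∧ Summit.FinalStateConjecture.exteriorOf 𝒟.toCauchyDevelopment (Ψ₀ '' W₀ ∪ ⋃ i, Ψ i '' W i) \ (Ψ₀ '' W₀ ∪ ⋃ i, Ψ i '' W i) ⊆ 𝒟.metric.causalPast 𝒟.timeOrientation S) → ∀ i, |a i| ≤ χ * M i)) 1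

/-- item stmt-FinalStateConjecture-9937 · support · rank 9 · open · by planner
sources: ChoquetBruhatGeroch1969CMP, Sbierski2016AHP, Ringstrom2009
[support] every admissible datum has a maximal globally hyperbolic vacuum development, stated over
the repaired structure `VacuumCauchyDevelopment` (the corrected form of the deprecated
`choquetBruhat_geroch_exists_mghd`, recorded in `CauchyProblemExistenceDefect`);
Choquet-Bruhat–Geroch 1969 Thm. 3, Sbierski 2016 Thm. 2.6. Known theorem; large formalisation;
shared by every route of this summit. [difficulty: XL] -/
@[route_item "route-FinalStateConjecture-QuietWindowCapture", crux]
def MGHDExists : Prop :=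
  ∀ (X : Type) [TopologicalSpace X] [ChartedSpace Literature.Geometry.Lorentzian.E3 X] [IsManifold (𝓡 3) ((⊤ : ℕ∞) : WithTop ℕ∞) X] [T2Space X] [SecondCountableTopology X] [ConnectedSpace X], ∀ D ∈ Literature.Geometry.Lorentzian.admissibleVacuumData X, ∃ 𝒟 : Literature.Geometry.Lorentzian.VacuumCauchyDevelopment D, 𝒟.IsMaximal

/-- item stmt-FinalStateConjecture-10117 · assembly · rank 1 · open · by planner
sources: DafermosLuk2017, Christodoulou1999
[assembly] QuietLeaves → Capture → GenericLegs → MGHDExists → FinalStateConjecture (the sub-problem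
Statement decl, root level). -/
@[route_item "route-FinalStateConjecture-QuietWindowCapture"]
def Assembly : Prop :=
  QuietLeaves → Capture → GenericLegs → MGHDExists → FinalStateConjecture

/-! D-0027 §2.1 — DECIDING THEOREM (planner-authored via `route open/edit --closes-file`; by planner-plancard-FinalStateConjecture-FinalSt-7d35149b-0 2026-08-15T15:12:31Z):
its hypotheses are this route's items and its conclusion the sub-problem Statement (glue_lint), and it elaborates with this file. -/

/- D-0027 §2.1 deciding theorem for route QuietWindowCapture (rendered verbatim inside the route
   file): repackage the late near-Kerr leaves (QuietLeaves) with the margin (GenericLegs) into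
   Capture's hypothesis, then use that Christodoulou genericity is monotone under pointwise implication
   on the admissible class (MGHDExists supplies the anti-vacuity conjunct). -/
@[closes "route-FinalStateConjecture-QuietWindowCapture"] theorem closes : QuietLeaves → Capture → GenericLegs → MGHDExists → FinalStateConjecture := by
  intro h₁ h₂ h₃ h₄ X _ _ _ _ _ _ d hd
  -- through the exceptional datum `d` of the Statement's property passes the curve that GenericLegs
  -- provides for ITS property: pointwise on the admissible class, MGHDExists + QuietLeaves + Capture
  -- (with the margin repackaged onto the late leaves) upgrade the latter to the former.
  obtain ⟨F, hF, h0, hinj, hadm, hE⟩ := h₃ X d ⟨hd.1, fun h => hd.2 ⟨h₄ X d hd.1, fun 𝒟 hmax =>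
    ⟨(h 𝒟 hmax).1, h₂ X d hd.1 𝒟 hmax (h 𝒟 hmax).1
      (by
            obtain ⟨χ, k₁, ε₁, hχ, hε₁, hM⟩ := (h 𝒟 hmax).2
            obtain ⟨N₀, m₀, hm₀, hA⟩ := h₁ X d hd.1 𝒟 hmax (h 𝒟 hmax).1
            exact ⟨N₀, m₀, χ, k₁, ε₁, hm₀, hχ, hε₁, fun k ε hε K hK => by
              obtain ⟨N, M, a, S, hN, hb, hdis, hL⟩ := hA k ε hε K hK
              exact ⟨N, M, a, S, hN, hb, hdis, hL, fun hk hε' => hM k ε hk hε' N M a S hL⟩⟩)⟩⟩⟩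
  exact ⟨F, hF, h0, hinj, hadm, fun c hc hmem => hE c hc ⟨hmem.1, fun h => hmem.2 ⟨h₄ X (F c) hmem.1,
    fun 𝒟 hmax => ⟨(h 𝒟 hmax).1, h₂ X (F c) hmem.1 𝒟 hmax (h 𝒟 hmax).1
      (by
            obtain ⟨χ, k₁, ε₁, hχ, hε₁, hM⟩ := (h 𝒟 hmax).2
            obtain ⟨N₀, m₀, hm₀, hA⟩ := h₁ X (F c) hmem.1 𝒟 hmax (h 𝒟 hmax).1
            exact ⟨N₀, m₀, χ, k₁, ε₁, hm₀, hχ, hε₁, fun k ε hε K hK => by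
              obtain ⟨N, M, a, S, hN, hb, hdis, hL⟩ := hA k ε hε K hK
              exact ⟨N, M, a, S, hN, hb, hdis, hL, fun hk hε' => hM k ε hk hε' N M a S hL⟩⟩)⟩⟩⟩⟩

end Summit.FinalStateConjecture.FinalStateConjecture.Theses.QuietWindowCapture
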